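import Summits.AtomisticToContinuum.HydrodynamicLimit.Theorems.KineticFluxLdDecay.Negative.TiltBasics
import Summits.AtomisticToContinuum.HydrodynamicLimit.Theorems.PolynomialCompression.Negative.PdeForm
import Summits.AtomisticToContinuum.HydrodynamicLimit.Theorems.InformationPercolationEngineChaosClosesEulerMaxwellianMoments
import Summits.AtomisticToContinuum.HydrodynamicLimit.Theorems.JParityClosureEvenStressEnskogEnskogIdentificationFields
import Mathlib.Probability.ConditionalProbability
import Mathlib.Probability.Moments.Variance
import Mathlib.MeasureTheory.Function.L2Space

/-!
# Tools for stub B′ (`stub_initialMatching`) of the line `contact-asymmetry-information`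
# (crux `InformationPercolationEngine.LocalSecondLaw` ≡ `JParityClosure.LocalSecondLaw`, stmt-AtomisticToContinuum-13081)

Three self-contained inputs of the initial-matching stub (the smeared Résibois `H`-density of the CONDITIONED local
Gibbs law `P_N(· | S)` at `s = 0` against the Euler datum's entropy `∫ Hs(ρ(0), θ(0)) φ(0)`):

* **The conditioning lemma, variance form** (`abs_integral_cond_sub_integral_le`,
  `abs_integral_cond_sub_integral_le_of_le`): for a probability measure `μ`, an event `S` with `μ(S) ≥ δ > 0` and an
  observable `A ∈ L²(μ)`,
  `|E_{μ(·|S)} A − E_μ A| ≤ √(Var_μ(A) / δ)`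
  (Cauchy–Schwarz against `𝟙_S`: `∫_S (A − E A) ≤ √μ(S) · √Var A`).  With `A = (N+1)⁻¹ ∑ᵢ G(zᵢ)` this converts every
  variance bound UNDER THE LOCAL GIBBS LAW that is uniform over bounded measurable one-body observables `|G| ≤ 1` into
  total-variation closeness of the one-particle marginal of EVERY conditioned law `P_N(· | S)`, `P_N(S) ≥ δ″`, to the
  unconditioned one — uniformly in `S`, with no use of the pinning of `S`.  (`μ[|S]` is Mathlib's
  `ProbabilityTheory.cond`, definitionally the line's `condLaw μ S = (μ S)⁻¹ • μ.restrict S`.)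
* **The Maxwellian entropy identity** (`integral_localMaxwellian_mul_log`):
  `∫ M_{ρ,u,θ} log M_{ρ,u,θ} dv = ρ log ρ − (3/2) ρ log(2πθ) − (3/2) ρ = ρ log ρ − (3/2) ρ log θ − c₀ ρ`,
  `c₀ = (3/2)(1 + log 2π)` (the constant of the line's comparison density `h̄_kin = b_r ∗ h₁ + c₀ ρ̄ + ρ̄ f_ex(ρ̄σ³)`),
  with the integrability of `M log M` (the peculiar second moment `∫ M_{1,u,θ} ‖v − u‖² dv = 3θ` and the scaling
  `M_ρ = ρ M₁` are the tree's `EvenStressEnskog.integral_localMaxwellian_mul_norm_sub_sq` and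
  `ChaosClosesEulerMaxwellianMoments.localMaxwellian_eq_mul_one`, imported).
* **Data pinning at `t = 0` in the frame's shape** (`data_zero_eq_profiles`): below the statics threshold, every
  classical hard-sphere Euler solution tied at `t = 0` to the local Gibbs laws through a flow family has
  `(ρ, u, θ)(0) = (rhoLim (profileOf a₀) σ, u₀, θ₀)` — the tree's `PolynomialCompressionPDE.data_eq_of_flowFree` /
  `lln_rhoLim` / `tendstoHydroFieldsAt_zero_iff_flowFree` (`Theorems/PolynomialCompression/Negative/PdeForm.lean`)
  assembled once, so that B′ can read the Euler datum's temperature and velocity off the local-Gibbs profiles (the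
  earlier line's B `stub_initialLayer` needed the density only, `DenseExcursionAtTimeZero.density_zero_eq_rhoLim`).

References: elementary (Cauchy–Schwarz; Gaussian moments).  C. Kipnis, C. Landim, *Scaling Limits of Interacting
Particle Systems* (1999), App. 1 §8 (conditioning and entropy bounds in the relative-entropy method); H. Spohn, *Large
Scale Dynamics of Interacting Particles* (1991), Part I §2.3 (local Maxwellians).
-/

noncomputable section

open MeasureTheory ProbabilityTheory Real Filter
open scoped ENNReal InnerProductSpace

namespace Summit.AtomisticToContinuum.HydrodynamicLimit.Theorems
namespace LocalSecondLawInitialMatching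

/-! ## 1. Conditioning on an event of non-negligible mass: the variance form of the conditioning lemma -/

section Conditioning

variable {Ω : Type*} [MeasurableSpace Ω] {μ : Measure Ω}

/-- **Cauchy–Schwarz against an indicator**: `|∫_S g dμ| ≤ √μ(S) · √(∫ g² dμ)` for `g ∈ L²(μ)` (Hölder `(2,2)` for
`𝟙_S · |g|`). -/
theorem abs_setIntegral_le_sqrt_mul_sqrt [IsFiniteMeasure μ] {S : Set Ω} (hS : MeasurableSet S)
    {g : Ω → ℝ} (hg : MemLp g 2 μ) :
    |∫ ω in S, g ω ∂μ| ≤ Real.sqrt (μ.real S) * Real.sqrt (∫ ω, g ω ^ 2 ∂μ) := by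
  have h1 : |∫ ω in S, g ω ∂μ| ≤ ∫ ω in S, |g ω| ∂μ := abs_integral_le_integral_abs
  have h2 : ∫ ω in S, |g ω| ∂μ = ∫ ω, S.indicator (fun _ => (1 : ℝ)) ω * |g ω| ∂μ := by
    rw [← integral_indicator hS]
    refine integral_congr_ae (Eventually.of_forall fun ω => ?_)
    by_cases hω : ω ∈ S <;> simp [hω]
  have hf_nonneg : 0 ≤ᵐ[μ] S.indicator (fun _ => (1 : ℝ)) :=
    Eventually.of_forall fun ω => Set.indicator_nonneg (fun _ _ => zero_le_one) ω
  have hg_nonneg : 0 ≤ᵐ[μ] fun ω => |g ω| := Eventually.of_forall fun ω => abs_nonneg _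
  have hf2 : MemLp (S.indicator fun _ => (1 : ℝ)) (ENNReal.ofReal 2) μ := by
    rw [ENNReal.ofReal_ofNat]
    exact (memLp_const 1).indicator hS
  have hg2 : MemLp (fun ω => |g ω|) (ENNReal.ofReal 2) μ := by
    rw [ENNReal.ofReal_ofNat]
    exact hg.abs
  have hH := integral_mul_le_Lp_mul_Lq_of_nonneg Real.HolderConjugate.two_two hf_nonneg hg_nonneg hf2 hg2
  have hA : ∫ ω, S.indicator (fun _ => (1 : ℝ)) ω ^ (2 : ℝ) ∂μ = μ.real S := by
    have : (fun ω => S.indicator (fun _ => (1 : ℝ)) ω ^ (2 : ℝ)) = S.indicator fun _ => (1 : ℝ) := by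
      funext ω
      by_cases hω : ω ∈ S
      · simp [hω]
      · simp [hω, Real.zero_rpow two_ne_zero]
    rw [this, integral_indicator_const _ hS, smul_eq_mul, mul_one]
  have hB : ∫ ω, |g ω| ^ (2 : ℝ) ∂μ = ∫ ω, g ω ^ 2 ∂μ := by
    refine integral_congr_ae (Eventually.of_forall fun ω => ?_)
    simp only [Real.rpow_two, sq_abs]
  rw [hA, hB] at hH
  calc |∫ ω in S, g ω ∂μ| ≤ ∫ ω in S, |g ω| ∂μ := h1
    _ = ∫ ω, S.indicator (fun _ => (1 : ℝ)) ω * |g ω| ∂μ := h2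
    _ ≤ (μ.real S) ^ (1 / (2 : ℝ)) * (∫ ω, g ω ^ 2 ∂μ) ^ (1 / (2 : ℝ)) := hH
    _ = Real.sqrt (μ.real S) * Real.sqrt (∫ ω, g ω ^ 2 ∂μ) := by
        rw [Real.sqrt_eq_rpow, Real.sqrt_eq_rpow]

/-- **Fluctuation of an `L²` observable on an event**: `|∫_S A dμ − μ(S) · E_μ A| ≤ √μ(S) · √Var_μ(A)` for a
probability measure `μ` (Cauchy–Schwarz applied to `A − E_μ A`). -/
theorem abs_setIntegral_sub_mul_integral_le [IsProbabilityMeasure μ] {S : Set Ω} (hS : MeasurableSet S)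
    {A : Ω → ℝ} (hA : MemLp A 2 μ) :
    |(∫ ω in S, A ω ∂μ) - μ.real S * ∫ ω, A ω ∂μ| ≤ Real.sqrt (μ.real S) * Real.sqrt (variance A μ) := by
  set m : ℝ := ∫ ω, A ω ∂μ with hm
  have hg : MemLp (fun ω => A ω - m) 2 μ := hA.sub (memLp_const m)
  have h := abs_setIntegral_le_sqrt_mul_sqrt hS hg
  have hAi : Integrable A μ := hA.integrable one_le_two
  have h1 : ∫ ω in S, (A ω - m) ∂μ = (∫ ω in S, A ω ∂μ) - μ.real S * m := by
    rw [integral_sub hAi.integrableOn (integrable_const m).integrableOn, setIntegral_const, smul_eq_mul]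
  have h2 : ∫ ω, (A ω - m) ^ 2 ∂μ = variance A μ :=
    (variance_eq_integral hA.aestronglyMeasurable.aemeasurable).symm
  rw [h1, h2] at h
  exact h

/-- The mean under the conditioned law `μ(· | S)` is the normalised restricted integral. -/
theorem integral_cond_eq_inv_mul_setIntegral (S : Set Ω) (A : Ω → ℝ) :
    ∫ ω, A ω ∂(μ[|S]) = (μ.real S)⁻¹ * ∫ ω in S, A ω ∂μ := by
  rw [ProbabilityTheory.cond, integral_smul_measure, ENNReal.toReal_inv, smul_eq_mul, measureReal_def]

/-- The conditioned law is a bounded tilt: `μ(· | S) ≤ μ(S)⁻¹ · μ`. -/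
theorem cond_le_inv_smul (S : Set Ω) : μ[|S] ≤ (μ S)⁻¹ • μ := by
  rw [ProbabilityTheory.cond, Measure.le_iff]
  intro t _
  simp only [Measure.smul_apply, smul_eq_mul]
  exact mul_le_mul' le_rfl (Measure.le_iff'.1 Measure.restrict_le_self t)

/-- Integrability transfers to the conditioned law of an event of positive mass. -/
theorem integrable_cond_of_integrable {S : Set Ω} (hS0 : μ S ≠ 0) {E : Type*} [NormedAddCommGroup E]
    {F : Ω → E} (hF : Integrable F μ) : Integrable F (μ[|S]) := by
  rw [ProbabilityTheory.cond]
  exact (hF.restrict (s := S)).smul_measure (ENNReal.inv_ne_top.2 hS0)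

/-- **The conditioning lemma (variance form).** For a probability measure `μ`, an event `S` of positive mass and
`A ∈ L²(μ)`: `|E_{μ(·|S)} A − E_μ A| ≤ √(Var_μ(A) / μ(S))`. -/
theorem abs_integral_cond_sub_integral_le [IsProbabilityMeasure μ] {S : Set Ω} (hS : MeasurableSet S)
    (hS0 : μ S ≠ 0) {A : Ω → ℝ} (hA : MemLp A 2 μ) :
    |(∫ ω, A ω ∂(μ[|S])) - ∫ ω, A ω ∂μ| ≤ Real.sqrt (variance A μ / μ.real S) := by
  have hp : 0 < μ.real S := by
    rw [measureReal_def]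
    exact ENNReal.toReal_pos hS0 (measure_ne_top μ S)
  have h := abs_setIntegral_sub_mul_integral_le hS hA
  rw [integral_cond_eq_inv_mul_setIntegral]
  have key : (μ.real S)⁻¹ * (∫ ω in S, A ω ∂μ) - ∫ ω, A ω ∂μ =
      (μ.real S)⁻¹ * ((∫ ω in S, A ω ∂μ) - μ.real S * ∫ ω, A ω ∂μ) := by
    field_simp
  rw [key, abs_mul, abs_inv, abs_of_pos hp]
  have hs0 : 0 < Real.sqrt (μ.real S) := Real.sqrt_pos.2 hp
  have hsq : Real.sqrt (μ.real S) * Real.sqrt (μ.real S) = μ.real S := Real.mul_self_sqrt hp.le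
  calc (μ.real S)⁻¹ * |(∫ ω in S, A ω ∂μ) - μ.real S * ∫ ω, A ω ∂μ|
      ≤ (μ.real S)⁻¹ * (Real.sqrt (μ.real S) * Real.sqrt (variance A μ)) :=
        mul_le_mul_of_nonneg_left h (inv_nonneg.2 hp.le)
    _ = Real.sqrt (variance A μ) / Real.sqrt (μ.real S) := by
        have hne : Real.sqrt (μ.real S) ≠ 0 := hs0.ne'
        nth_rewrite 1 [← hsq]
        rw [mul_inv, mul_assoc, inv_mul_cancel_left₀ hne, div_eq_inv_mul]
    _ = Real.sqrt (variance A μ / μ.real S) := (Real.sqrt_div' _ hp.le).symm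

/-- **The conditioning lemma with a mass floor**: if `μ(S) ≥ δ > 0` then
`|E_{μ(·|S)} A − E_μ A| ≤ √(Var_μ(A) / δ)` — uniformly over all such events `S`. -/
theorem abs_integral_cond_sub_integral_le_of_le [IsProbabilityMeasure μ] {S : Set Ω} (hS : MeasurableSet S)
    {δ : ℝ} (hδ : 0 < δ) (hδS : ENNReal.ofReal δ ≤ μ S) {A : Ω → ℝ} (hA : MemLp A 2 μ) :
    |(∫ ω, A ω ∂(μ[|S])) - ∫ ω, A ω ∂μ| ≤ Real.sqrt (variance A μ / δ) := by
  have hδp : δ ≤ μ.real S := by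
    rw [measureReal_def]
    exact (ENNReal.ofReal_le_iff_le_toReal (measure_ne_top μ S)).1 hδS
  have hS0 : μ S ≠ 0 := by
    intro h0
    rw [h0, nonpos_iff_eq_zero, ENNReal.ofReal_eq_zero] at hδS
    exact absurd hδS (not_le.2 hδ)
  refine (abs_integral_cond_sub_integral_le hS hS0 hA).trans (Real.sqrt_le_sqrt ?_)
  exact div_le_div_of_nonneg_left (variance_nonneg A μ) hδ hδp

/-- **Bounded observables**: for `|A| ≤ C` measurable, `μ(S) ≥ δ > 0`,
`|E_{μ(·|S)} A − E_μ A| ≤ √(Var_μ(A) / δ)` with `A ∈ L²` automatic — the form consumed with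
`A = (N+1)⁻¹ ∑ᵢ G(zᵢ)`, `|G| ≤ 1`. -/
theorem abs_integral_cond_sub_integral_le_of_bound [IsProbabilityMeasure μ] {S : Set Ω}
    (hS : MeasurableSet S) {δ : ℝ} (hδ : 0 < δ) (hδS : ENNReal.ofReal δ ≤ μ S) {A : Ω → ℝ}
    (hAm : AEStronglyMeasurable A μ) {C : ℝ} (hAC : ∀ ω, |A ω| ≤ C) :
    |(∫ ω, A ω ∂(μ[|S])) - ∫ ω, A ω ∂μ| ≤ Real.sqrt (variance A μ / δ) :=
  abs_integral_cond_sub_integral_le_of_le hS hδ hδS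
    (MemLp.of_bound hAm C (Eventually.of_forall fun ω => (Real.norm_eq_abs _).trans_le (hAC ω)))

/-- **The conditioning lemma of the line, registered form** (explicit law; sub-goal `conditioningLemma_variance` of
stmt-AtomisticToContinuum-13081): for a probability law `μ`, an event `S` of mass `≥ δ > 0` and `A ∈ L²(μ)`,
`|E_{μ(·|S)} A − E_μ A| ≤ √(Var_μ(A) / δ)`. -/
theorem conditioningLemma_variance : ∀ {Ω : Type*} [MeasurableSpace Ω] (μ : Measure Ω) [IsProbabilityMeasure μ]
    (S : Set Ω), MeasurableSet S → ∀ δ : ℝ, 0 < δ → ENNReal.ofReal δ ≤ μ S → ∀ A : Ω → ℝ, MemLp A 2 μ →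
      |(∫ ω, A ω ∂(ProbabilityTheory.cond μ S)) - ∫ ω, A ω ∂μ| ≤ Real.sqrt (ProbabilityTheory.variance A μ / δ) :=
  fun μ _ _ hS _ hδ hδS _ hA => abs_integral_cond_sub_integral_le_of_le (μ := μ) hS hδ hδS hA

end Conditioning

/-! ## 2. The Maxwellian entropy identity -/

section MaxwellEntropy

open Literature.Analysis.FluidPDE Literature.MathematicalPhysics.KineticTheory

/-- Pointwise form of the entropy integrand:
`M_ρ log M_ρ = (ρ log ρ − (3/2) ρ log(2πθ)) M₁ − (ρ/(2θ)) M₁ ‖v − u‖²`. -/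
theorem localMaxwellian_mul_log_eq {θ : ℝ} (hθ : 0 < θ) (ρ : ℝ) (u v : V3) :
    localMaxwellian ρ θ u v * Real.log (localMaxwellian ρ θ u v) =
      (ρ * Real.log ρ - 3 / 2 * ρ * Real.log (2 * Real.pi * θ)) * localMaxwellian 1 θ u v -
        ρ / (2 * θ) * (localMaxwellian 1 θ u v * ‖v - u‖ ^ 2) := by
  rcases eq_or_ne ρ 0 with rfl | hρ
  · simp [ChaosClosesEulerMaxwellianMoments.localMaxwellian_eq_mul_one 0]
  · have hM : localMaxwellian 1 θ u v ≠ 0 := (localMaxwellian_pos one_pos hθ u v).ne'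
    rw [ChaosClosesEulerMaxwellianMoments.localMaxwellian_eq_mul_one ρ, Real.log_mul hρ hM,
      KineticFluxLdDecayTilt.log_localMaxwellian hθ u v]
    ring

/-- `M_ρ log M_ρ` is integrable in the velocity. -/
theorem integrable_localMaxwellian_mul_log {θ : ℝ} (hθ : 0 < θ) (ρ : ℝ) (u : V3) :
    Integrable fun v => localMaxwellian ρ θ u v * Real.log (localMaxwellian ρ θ u v) := by
  have h : (fun v => localMaxwellian ρ θ u v * Real.log (localMaxwellian ρ θ u v)) = fun v =>
      (ρ * Real.log ρ - 3 / 2 * ρ * Real.log (2 * Real.pi * θ)) * localMaxwellian 1 θ u v -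
        ρ / (2 * θ) * (localMaxwellian 1 θ u v * ‖v - u‖ ^ 2) :=
    funext fun v => localMaxwellian_mul_log_eq hθ ρ u v
  rw [h]
  exact ((integrable_localMaxwellian hθ u).const_mul _).sub
    ((EvenStressEnskog.integrable_localMaxwellian_mul_norm_sub_sq hθ u).const_mul _)

/-- **The Maxwellian entropy identity**: `∫ M_{ρ,u,θ} log M_{ρ,u,θ} dv = ρ log ρ − (3/2) ρ log(2πθ) − (3/2) ρ`
(`θ > 0`; every real `ρ` — for `ρ = 0` both sides vanish, for `ρ < 0` Mathlib's `log |·|` keeps it true). -/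
theorem integral_localMaxwellian_mul_log {θ : ℝ} (hθ : 0 < θ) (ρ : ℝ) (u : V3) :
    ∫ v, localMaxwellian ρ θ u v * Real.log (localMaxwellian ρ θ u v) =
      ρ * Real.log ρ - 3 / 2 * ρ * Real.log (2 * Real.pi * θ) - 3 / 2 * ρ := by
  have h : (fun v => localMaxwellian ρ θ u v * Real.log (localMaxwellian ρ θ u v)) = fun v =>
      (ρ * Real.log ρ - 3 / 2 * ρ * Real.log (2 * Real.pi * θ)) * localMaxwellian 1 θ u v -
        ρ / (2 * θ) * (localMaxwellian 1 θ u v * ‖v - u‖ ^ 2) :=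
    funext fun v => localMaxwellian_mul_log_eq hθ ρ u v
  rw [h, integral_sub ((integrable_localMaxwellian hθ u).const_mul _)
    ((EvenStressEnskog.integrable_localMaxwellian_mul_norm_sub_sq hθ u).const_mul _), integral_const_mul,
    integral_const_mul, integral_localMaxwellian_one hθ u,
    EvenStressEnskog.integral_localMaxwellian_mul_norm_sub_sq hθ u]
  have hθ0 : θ ≠ 0 := hθ.ne'
  field_simp

/-- **The identity in the line's normalisation**: `∫ M log M dv = ρ log ρ − (3/2) ρ log θ − c₀ ρ` with
`c₀ = (3/2)(1 + log 2π)` (the constant of the comparison density `h̄_kin = b_r ∗ h₁ + c₀ ρ̄ + ρ̄ f_ex(ρ̄σ³)`). -/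
theorem integral_localMaxwellian_mul_log_eq_c0 {θ : ℝ} (hθ : 0 < θ) (ρ : ℝ) (u : V3) :
    ∫ v, localMaxwellian ρ θ u v * Real.log (localMaxwellian ρ θ u v) =
      ρ * Real.log ρ - 3 / 2 * ρ * Real.log θ - 3 / 2 * (1 + Real.log (2 * Real.pi)) * ρ := by
  rw [integral_localMaxwellian_mul_log hθ ρ u, Real.log_mul (by positivity) hθ.ne']
  ring

/-- **Gibbs' inequality consequence, sign form**: with unit density the Maxwellian entropy is
`−(3/2) log(2πθ) − 3/2`, so `∫ M₁ log M₁ ≤ 0` exactly when `2πθ ≥ e⁻¹`; recorded in the useful direction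
`∫ M_{1,u,θ} log M_{1,u,θ} = −(3/2)(log(2πθ) + 1)`. -/
theorem integral_localMaxwellian_one_mul_log {θ : ℝ} (hθ : 0 < θ) (u : V3) :
    ∫ v, localMaxwellian 1 θ u v * Real.log (localMaxwellian 1 θ u v) =
      -(3 / 2) * (Real.log (2 * Real.pi * θ) + 1) := by
  rw [integral_localMaxwellian_mul_log hθ 1 u, Real.log_one]
  ring

end MaxwellEntropy

/-! ## 3. Data pinning at `t = 0` in the frame's shape -/

section DataPinning

open Literature.Analysis.FluidPDE Literature.MathematicalPhysics.KineticTheory Set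

/-- **Data pinning at `t = 0`.** For continuous profiles `a₀, θ₀ > 0`, `u₀` there is `σ₁ ∈ (0, 1/2]` such that for
`0 < σ < σ₁` the statics package `SmallDensity (profileOf a₀) σ` holds, the pinned density `rhoLim (profileOf a₀) σ` is
positive, and EVERY classical hard-sphere Euler solution on `[0, T)`, `T > 0`, tied at `t = 0` to the local Gibbs laws
through some flow family has time-`0` data `ρ 0 = rhoLim (profileOf a₀) σ`, `u 0 = u₀`, `θ 0 = θ₀` (uniqueness of
limits in probability against the tree's law of large numbers; `PolynomialCompressionPDE.data_eq_of_flowFree`). -/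
theorem data_zero_eq_profiles {a₀ θ₀ : T3 → ℝ} {u₀ : T3 → V3} (ha : Continuous a₀) (hθ : Continuous θ₀)
    (hu : Continuous u₀) (ha0 : ∀ x, 0 < a₀ x) (hθ0 : ∀ x, 0 < θ₀ x) :
    ∃ σ₁ : ℝ, 0 < σ₁ ∧ σ₁ ≤ 1 / 2 ∧ ∀ σ : ℝ, 0 < σ → σ < σ₁ →
      SmallDensity (profileOf a₀ ha ha0) σ ∧ (∀ x, 0 < rhoLim (profileOf a₀ ha ha0) σ x) ∧
      ∀ (T : ℝ) (ρ θ : ℝ → T3 → ℝ) (u : ℝ → T3 → V3), IsHardSphereEulerSolution σ T ρ u θ → 0 < T →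
        ∀ Φ : PolynomialCompressionPDE.Flows σ,
          TendstoHydroFieldsAt (fun N => localGibbsLaw σ a₀ u₀ θ₀ N (Φ N)) Φ ρ u θ 0 →
            ρ 0 = rhoLim (profileOf a₀ ha ha0) σ ∧ u 0 = u₀ ∧ θ 0 = θ₀ := by
  obtain ⟨σ₁, hσ₁, hσ₁2, H⟩ := PolynomialCompressionPDE.lln_rhoLim ha hθ hu ha0 hθ0
  refine ⟨σ₁, hσ₁, hσ₁2, fun σ hσ hσlt => ?_⟩
  obtain ⟨h, hpos, Hσ⟩ := H σ hσ hσlt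
  refine ⟨h, fun x => h.rhoLim_pos (hpos x), fun T ρ θ u hE hT Φ htie => ?_⟩
  have hσ2 : σ ≤ 1 / 2 := (hσlt.trans_le hσ₁2).le
  obtain ⟨hρc, huc, hθc⟩ := PolynomialCompressionPDE.continuous_slices_zero hE hT
  -- (no expected types: the constant-in-time slices `(fun _ => c) 0` beta-reduce on instantiation)
  have hlln := (PolynomialCompressionPDE.tendstoHydroFieldsAt_zero_iff_flowFree Φ).1 (Hσ Φ).2
  have ht := (PolynomialCompressionPDE.tendstoHydroFieldsAt_zero_iff_flowFree Φ).1 htie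
  exact PolynomialCompressionPDE.data_eq_of_flowFree ha hθ hu ha0 hθ0 hσ2 h.continuous_rhoLim
    (fun x => h.rhoLim_pos (hpos x)) hlln hρc huc hθc ht

/-- **The pinned datum lies in any prescribed packing band for `σ` small**: with the `σ`-uniform bound
`rhoLim < (2e+1)·M` (`DenseExcursionAtTimeZero.rhoLim_lt`), for `σ < min 1 (η₀/((2e+1)M))` one has
`rhoLim(x) σ³ < η₀` at every `x` where `rhoLim(x) ≥ 0` (the EOS-band guard of `Hs`; the computation inside the earlier
line's `stub_initialLayer`, exposed for reuse). -/
theorem rhoLim_mul_pow_three_lt {a₀ : T3 → ℝ} (ha : Continuous a₀) (ha0 : ∀ x, 0 < a₀ x) {σ η₀ : ℝ}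
    (h : SmallDensity (profileOf a₀ ha ha0) σ) (hσ : 0 < σ) (hσ1 : σ < 1)
    (hσA : σ < η₀ / ((2 * Real.exp 1 + 1) * (profileOf a₀ ha ha0).M)) {x : T3}
    (h0 : 0 ≤ rhoLim (profileOf a₀ ha ha0) σ x) :
    rhoLim (profileOf a₀ ha ha0) σ x * σ ^ 3 < η₀ := by
  set A : ℝ := (2 * Real.exp 1 + 1) * (profileOf a₀ ha ha0).M with hA
  have hApos : 0 < A := by have := (profileOf a₀ ha ha0).M_pos; positivity
  have h1 : rhoLim (profileOf a₀ ha ha0) σ x < A := DenseExcursionAtTimeZero.rhoLim_lt h x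
  have h3 : σ ^ 3 ≤ σ := by
    have h2 : σ ^ 2 ≤ 1 := by nlinarith
    nlinarith
  have hAσ : A * σ < η₀ := by rwa [lt_div_iff₀ hApos, mul_comm] at hσA
  calc rhoLim (profileOf a₀ ha ha0) σ x * σ ^ 3 ≤ rhoLim (profileOf a₀ ha ha0) σ x * σ :=
        mul_le_mul_of_nonneg_left h3 h0
    _ ≤ A * σ := mul_le_mul_of_nonneg_right h1.le hσ.le
    _ < η₀ := hAσ

end DataPinning

end LocalSecondLawInitialMatching
end Summit.AtomisticToContinuum.HydrodynamicLimit.Theorems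

end
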